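import Mathlib.RingTheory.Valuation.Basic
import Mathlib.Analysis.Normed.Ring.Lemmas
import Mathlib.Tactic
import HarnessLib

/-!
# The Kummer function `f_T = xy - n x² + n² y` of the Kubert–Tate `5`-torsion family takes values
# of fifth-power valuation at every place where `m, n` are units

PROOF-ONLY file (theorems, no definition, no named fact), topic `NumberTheory/EllipticCurves`.
Let `E_{m,n} = kubertTateFive m n : y² + (n - m) x y - m n² y = x³ - m n x²` be the integral model
of the universal elliptic curve with a point `T = (0,0)` of order `5` (Knapp (5.31), tree file
`KubertTateFive`), over any field `L` with a rank-one valuation `w : L → ℝ≥0` for which `m` and `n`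
are UNITS (`w m = w n = 1`). The function

  `f_T(x, y) = x y - n x² + n² y`

is the Kummer function of the `φ̂`-descent (divisor `5(T) - 5(O)`; Silverman *AEC* Exercise
10.1(c); for `11A3` in Tate normal form it is Mazur's `xy + x² + y` of `X1ElevenKummerValues` up to
the model change) and satisfies on the curve **`f_T · f_{-T} = -x⁵`**, `f_{-T}(x,y) =
f_T(x, -y - (n-m)x + mn²)` (`kummerFn_mul_kummerFn_neg`). By the valuation bookkeeping of
`X1ElevenKummerValues` (no group law is used, only the cubic equation):

* `exists_val_kummerFn_eq_pow` — **for every affine point `(x, y) ≠ T` of `E_{m,n}` over `L` there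
  is `z ≠ 0` with `w(f_T(x,y)) = w(z)⁵`**: if `w x > 1` then `w(f_T) = w(y/x)⁵`; if `w x = 1`
  then `f_T`, `f_{-T}` are integral with product a unit; if `w x < 1` the point reduces to `T` or
  to `-T = (0, mn²)` and `w(f_T) = w(x)⁵`, resp. `= 1`.
* `kummerFn_ne_zero_of_ne` — in particular `f_T(x, y) ≠ 0` off `T`.

Consequence for the `5`-descent on `E_{13/14}` (sequel files): at the completions `ℚ_v`,
`v ∤ mn` — including `v = 5` and the primes of `m² - 11mn - n²` — `5 ∣ ord_v f_T(P)` for every local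
point `P ≠ O, T`, so the `φ̂`-Selmer group lies in the span of the primes of `mn` in `ℚˣ/ℚˣ⁵`
(T. Fisher, JEMS 3 (2001), §§1–2: the Selmer groups of the `5`-isogenies of the Tate normal form
in terms of the primes of `λ`).

## References

* [SilvermanAEC2009] J. H. Silverman, *The Arithmetic of Elliptic Curves*, 2nd ed., Exercise
  10.1(c), Thm. X.1.1(c) and its proof (the valuation argument), VII.§2.
* [Fisher2001FiveSevenDescent] T. Fisher, *Some examples of 5 and 7 descent for elliptic curves
  over ℚ*, JEMS 3 (2001) 169–201, §§1–2.
* [Knapp1993] A. W. Knapp, *Elliptic Curves*, (5.31).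

## Design

Theorems only, rank-one valuations `Valuation L ℝ≥0` (as in the tree's `GoodReductionInertia`:
the ordered arithmetic stays elementary; `ℤₘ₀`-valued valuations of `ℚ` and `ℚ_v` map into `ℝ≥0`
injectively by `WithZeroMulInt.toNNReal`). The point is given by its coordinates and the cubic
equation; `T = (0,0)` is excluded by `¬ (x = 0 ∧ y = 0)`.
-/

open scoped NNReal

namespace Literature.NumberTheory.EllipticCurves

namespace KubertTateKummer

variable {L : Type*} [Field L] (w : Valuation L ℝ≥0) {m n x y : L}

/-- **`f_T · f_{-T} = -x⁵` on `E_{m,n}`**: with `f_T = xy - nx² + n²y` and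
`f_{-T}(x, y) = f_T(x, -y - (n-m)x + mn²)` (the value of `f_T` at `-(x,y)`), the cubic equation
`y² + (n-m)xy - mn²y = x³ - mnx²` gives `f_T · f_{-T} = -x⁵`. [cite: SilvermanAEC2009, Exercise 10.1(c)] -/
theorem kummerFn_mul_kummerFn_neg
    (he : y ^ 2 + (n - m) * x * y - m * n ^ 2 * y = x ^ 3 - m * n * x ^ 2) :
    (x * y - n * x ^ 2 + n ^ 2 * y) *
      (x * (-y - (n - m) * x + m * n ^ 2) - n * x ^ 2 + n ^ 2 * (-y - (n - m) * x + m * n ^ 2)) =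
      -x ^ 5 := by
  linear_combination (-(x ^ 2) - 2 * n ^ 2 * x - n ^ 4) * he

/-- The cubic equation in factored form: `y · (y + (n-m)x - mn²) = x² · (x - mn)`. [cite: Knapp1993, (5.31)] -/
theorem eqn_factored (he : y ^ 2 + (n - m) * x * y - m * n ^ 2 * y = x ^ 3 - m * n * x ^ 2) :
    y * (y + (n - m) * x - m * n ^ 2) = x ^ 2 * (x - m * n) := by
  linear_combination he

section Units

variable (hm : w m = 1) (hn : w n = 1)
include hm hn

/-- `w (n - m) ≤ 1`. [cite: SilvermanAEC2009, VII.§2] -/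
theorem val_n_sub_m_le : w (n - m) ≤ 1 :=
  (Valuation.map_sub w n m).trans (max_le hn.le hm.le)

/-- `w (m n²) = 1`. [cite: SilvermanAEC2009, VII.§2] -/
theorem val_mn2 : w (m * n ^ 2) = 1 := by rw [map_mul, map_pow, hm, hn, one_pow, one_mul]

/-- **Integral points have integral `y`**: `w x ≤ 1 → w y ≤ 1` (if `w y > 1 ≥ w x` the term `y²`
strictly dominates the equation). [cite: SilvermanAEC2009, VII.§2] -/
theorem val_y_le_one (he : y ^ 2 + (n - m) * x * y - m * n ^ 2 * y = x ^ 3 - m * n * x ^ 2)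
    (hx : w x ≤ 1) : w y ≤ 1 := by
  by_contra hy
  push Not at hy
  have hf := eqn_factored he
  -- `w (y + (n-m)x - mn²) = w y` since the other two terms have valuation `≤ 1 < w y`
  have h2 : w ((n - m) * x - m * n ^ 2) < w y := by
    refine lt_of_le_of_lt (Valuation.map_sub w _ _) (max_lt ?_ ?_)
    · rw [map_mul]; exact lt_of_le_of_lt (mul_le_one' (val_n_sub_m_le w hm hn) hx) hy
    · rw [val_mn2 w hm hn]; exact hy
  have h3 : w (y + (n - m) * x - m * n ^ 2) = w y := by
    rw [show y + (n - m) * x - m * n ^ 2 = y + ((n - m) * x - m * n ^ 2) by ring]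
    exact Valuation.map_add_eq_of_lt_left w h2
  -- LHS valuation `w y * w y > 1`, RHS `≤ 1`
  have hL : 1 < w (y * (y + (n - m) * x - m * n ^ 2)) := by
    rw [map_mul, h3]; exact one_lt_mul'' hy hy
  have hR : w (x ^ 2 * (x - m * n)) ≤ 1 := by
    rw [map_mul, map_pow]
    refine mul_le_one' (pow_le_one' hx 2) ((Valuation.map_sub w _ _).trans (max_le hx ?_))
    rw [map_mul, hm, hn, one_mul]
  rw [hf] at hL
  exact absurd (hL.trans_le hR) (lt_irrefl 1)

/-- **Non-integral points**: if `w x > 1` then `w y > w x`, `w y · w y = w x ³` and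
`w (f_T(x,y)) = w (y/x)⁵` with `y/x ≠ 0`. [cite: SilvermanAEC2009, Thm. X.1.1(c) (proof) and VII.§2] -/
theorem val_kummerFn_of_one_lt
    (he : y ^ 2 + (n - m) * x * y - m * n ^ 2 * y = x ^ 3 - m * n * x ^ 2) (hx : 1 < w x) :
    y / x ≠ 0 ∧ w (x * y - n * x ^ 2 + n ^ 2 * y) = w (y / x) ^ 5 := by
  have hx0 : x ≠ 0 := fun h ↦ by rw [h, map_zero] at hx; exact not_lt_zero hx
  have hwx0 : (0 : ℝ≥0) < w x := zero_lt_one.trans hx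
  have hf := eqn_factored he
  have hxmn : w (x - m * n) = w x :=
    Valuation.map_sub_eq_of_lt_left w (by rw [map_mul, hm, hn, one_mul]; exact hx)
  have hR : w (x ^ 2 * (x - m * n)) = w x ^ 3 := by rw [map_mul, map_pow, hxmn]; ring
  -- `w y > w x`
  have hyx : w x < w y := by
    by_contra hyx
    push Not at hyx
    have hB : w (y + (n - m) * x - m * n ^ 2) ≤ w x := by
      refine (Valuation.map_sub w _ _).trans (max_le ((Valuation.map_add w _ _).trans
        (max_le hyx ?_)) ?_)
      · rw [map_mul]; exact mul_le_of_le_one_left' (val_n_sub_m_le w hm hn)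
      · rw [val_mn2 w hm hn]; exact hx.le
    have hL : w (y * (y + (n - m) * x - m * n ^ 2)) ≤ w x * w x := by
      rw [map_mul]; exact mul_le_mul' hyx hB
    rw [hf, hR] at hL
    have hx2 : (0 : ℝ≥0) < w x ^ 2 := pow_pos hwx0 2
    have : w x ^ 2 * w x ≤ w x ^ 2 * 1 := by rw [mul_one, ← pow_succ, pow_two]; exact hL
    exact absurd (le_of_mul_le_mul_left this hx2) (not_le.mpr hx)
  have hy0 : y ≠ 0 := fun h ↦ by rw [h, map_zero] at hyx; exact not_lt_zero hyx
  -- `w (y + (n-m)x - mn²) = w y`, hence `w y * w y = w x ^ 3`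
  have hB : w (y + (n - m) * x - m * n ^ 2) = w y := by
    have hlt : w ((n - m) * x - m * n ^ 2) < w y := by
      refine lt_of_le_of_lt (Valuation.map_sub w _ _) (max_lt ?_ ?_)
      · rw [map_mul]
        exact lt_of_le_of_lt (mul_le_of_le_one_left' (val_n_sub_m_le w hm hn)) hyx
      · rw [val_mn2 w hm hn]; exact hx.trans hyx
    rw [show y + (n - m) * x - m * n ^ 2 = y + ((n - m) * x - m * n ^ 2) by ring]
    exact Valuation.map_add_eq_of_lt_left w hlt
  have hy2 : w y * w y = w x ^ 3 := by rw [← hR, ← hf, map_mul, hB]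
  -- the leading term `xy`
  have hlead : w (x * y - n * x ^ 2 + n ^ 2 * y) = w x * w y := by
    have h1 : w (-(n * x ^ 2) + n ^ 2 * y) < w (x * y) := by
      rw [map_mul]
      refine lt_of_le_of_lt (Valuation.map_add w _ _) (max_lt ?_ ?_)
      · rw [Valuation.map_neg, map_mul, map_pow, hn, one_mul, pow_two]
        exact mul_lt_mul_of_pos_left hyx hwx0
      · rw [map_mul, map_pow, hn, one_pow, one_mul]
        exact lt_mul_of_one_lt_left (hwx0.trans hyx) hx
    rw [show x * y - n * x ^ 2 + n ^ 2 * y = x * y + (-(n * x ^ 2) + n ^ 2 * y) by ring,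
      Valuation.map_add_eq_of_lt_left w h1, map_mul]
  refine ⟨div_ne_zero hy0 hx0, ?_⟩
  rw [hlead, map_div₀]
  have hxne : w x ≠ 0 := ne_of_gt hwx0
  rw [div_pow, eq_div_iff (pow_ne_zero 5 hxne)]
  calc w x * w y * w x ^ 5 = w y * (w x ^ 3) ^ 2 := by ring
    _ = w y * (w y * w y) ^ 2 := by rw [hy2]
    _ = w y ^ 5 := by ring

/-- **Points with `w x = 1`**: `f_T` and `f_{-T}` are integral with product `-x⁵` a unit, so
`w (f_T(x,y)) = 1`. [cite: SilvermanAEC2009, Thm. X.1.1(c) (proof)] -/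
theorem val_kummerFn_of_eq_one
    (he : y ^ 2 + (n - m) * x * y - m * n ^ 2 * y = x ^ 3 - m * n * x ^ 2) (hx : w x = 1) :
    w (x * y - n * x ^ 2 + n ^ 2 * y) = 1 := by
  have hy : w y ≤ 1 := val_y_le_one w hm hn he hx.le
  have hnm := val_n_sub_m_le w hm hn
  have hy' : w (-y - (n - m) * x + m * n ^ 2) ≤ 1 := by
    refine (Valuation.map_add w _ _).trans (max_le ((Valuation.map_sub w _ _).trans (max_le ?_ ?_)) ?_)
    · rw [Valuation.map_neg]; exact hy
    · rw [map_mul, hx, mul_one]; exact hnm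
    · exact (val_mn2 w hm hn).le
  -- both Kummer values are integral
  have hint : ∀ {y' : L}, w y' ≤ 1 → w (x * y' - n * x ^ 2 + n ^ 2 * y') ≤ 1 := fun {y'} hy' ↦ by
    refine (Valuation.map_add w _ _).trans (max_le ((Valuation.map_sub w _ _).trans (max_le ?_ ?_)) ?_)
    · rw [map_mul, hx, one_mul]; exact hy'
    · rw [map_mul, map_pow, hn, hx, one_pow, mul_one]
    · rw [map_mul, map_pow, hn, one_pow, one_mul]; exact hy'
  have h1 := hint hy
  have h2 := hint hy'
  have hprod := congrArg w (kummerFn_mul_kummerFn_neg he)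
  rw [map_mul, Valuation.map_neg, map_pow, hx, one_pow] at hprod
  -- `a ≤ 1`, `b ≤ 1`, `a * b = 1` in `ℝ≥0` forces `a = 1`
  by_contra hne
  have hlt : w (x * y - n * x ^ 2 + n ^ 2 * y) < 1 := lt_of_le_of_ne h1 hne
  have : w (x * y - n * x ^ 2 + n ^ 2 * y) *
      w (x * (-y - (n - m) * x + m * n ^ 2) - n * x ^ 2 + n ^ 2 * (-y - (n - m) * x + m * n ^ 2)) <
      1 := mul_lt_one_of_lt_of_le hlt h2
  rw [hprod] at this
  exact lt_irrefl 1 this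

/-- **Points reducing to `T`**: if `w x < 1` and `w y < 1` then `f_{-T}(x,y) ≡ mn⁴` is a unit
and `w (f_T(x,y)) = w(x)⁵`, with `x ≠ 0` unless `(x, y) = T`. [cite: SilvermanAEC2009, Thm. X.1.1(c) (proof)] -/
theorem val_kummerFn_of_lt_one_of_lt_one
    (he : y ^ 2 + (n - m) * x * y - m * n ^ 2 * y = x ^ 3 - m * n * x ^ 2) (hx : w x < 1)
    (hy : w y < 1) : w (x * y - n * x ^ 2 + n ^ 2 * y) = w x ^ 5 := by
  have hneg : w (x * (-y - (n - m) * x + m * n ^ 2) - n * x ^ 2 +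
      n ^ 2 * (-y - (n - m) * x + m * n ^ 2)) = 1 := by
    -- `= mn⁴ + (terms with a factor x or y)`
    have hsplit : x * (-y - (n - m) * x + m * n ^ 2) - n * x ^ 2 +
        n ^ 2 * (-y - (n - m) * x + m * n ^ 2) =
        m * n ^ 2 * n ^ 2 + (x * (-y - (n - m) * x + m * n ^ 2 - n * x - n ^ 2 * (n - m)) +
          -(n ^ 2 * y)) := by ring
    have hsmall : w (x * (-y - (n - m) * x + m * n ^ 2 - n * x - n ^ 2 * (n - m)) + -(n ^ 2 * y)) <
        1 := by
      refine lt_of_le_of_lt (Valuation.map_add w _ _) (max_lt ?_ ?_)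
      · rw [map_mul]
        refine mul_lt_one_of_lt_of_le hx ?_
        refine (Valuation.map_sub w _ _).trans (max_le ((Valuation.map_sub w _ _).trans (max_le
          ((Valuation.map_add w _ _).trans (max_le ((Valuation.map_sub w _ _).trans
            (max_le ?_ ?_)) (val_mn2 w hm hn).le)) ?_)) ?_)
        · rw [Valuation.map_neg]; exact hy.le
        · rw [map_mul]; exact mul_le_one' (val_n_sub_m_le w hm hn) hx.le
        · rw [map_mul, hn, one_mul]; exact hx.le
        · rw [map_mul, map_pow, hn, one_pow, one_mul]; exact val_n_sub_m_le w hm hn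
      · rw [Valuation.map_neg, map_mul, map_pow, hn, one_pow, one_mul]; exact hy
    rw [hsplit, Valuation.map_add_eq_of_lt_left w (by
      rw [map_mul, val_mn2 w hm hn, map_pow, hn, one_pow, one_mul]; exact hsmall),
      map_mul, val_mn2 w hm hn, map_pow, hn, one_pow, one_mul]
  have hprod := congrArg w (kummerFn_mul_kummerFn_neg he)
  rw [map_mul, hneg, mul_one, Valuation.map_neg, map_pow] at hprod
  exact hprod

/-- **Points reducing to `-T = (0, mn²)`**: if `w x < 1` and `w (y - mn²) < 1` then
`f_T(x,y) ≡ mn⁴` is a unit: `w (f_T(x,y)) = 1`. [cite: SilvermanAEC2009, Thm. X.1.1(c) (proof)] -/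
theorem val_kummerFn_of_lt_one_of_val_sub_lt_one
    (hx : w x < 1) (hy : w (y - m * n ^ 2) < 1) : w (x * y - n * x ^ 2 + n ^ 2 * y) = 1 := by
  have hyle : w y ≤ 1 := by
    rw [show y = (y - m * n ^ 2) + m * n ^ 2 by ring]
    exact (Valuation.map_add w _ _).trans (max_le hy.le (val_mn2 w hm hn).le)
  have hsplit : x * y - n * x ^ 2 + n ^ 2 * y =
      m * n ^ 2 * n ^ 2 + (x * (y - n * x) + n ^ 2 * (y - m * n ^ 2)) := by ring
  have hsmall : w (x * (y - n * x) + n ^ 2 * (y - m * n ^ 2)) < 1 := by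
    refine lt_of_le_of_lt (Valuation.map_add w _ _) (max_lt ?_ ?_)
    · rw [map_mul]
      refine mul_lt_one_of_lt_of_le hx ((Valuation.map_sub w _ _).trans (max_le hyle ?_))
      rw [map_mul, hn, one_mul]; exact hx.le
    · rw [map_mul, map_pow, hn, one_pow, one_mul]; exact hy
  rw [hsplit, Valuation.map_add_eq_of_lt_left w (by
    rw [map_mul, val_mn2 w hm hn, map_pow, hn, one_pow, one_mul]; exact hsmall),
    map_mul, val_mn2 w hm hn, map_pow, hn, one_pow, one_mul]

/-- **The dichotomy at an integral point with `w x < 1`**: the point reduces to `T` (`w y < 1`) or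
to `-T` (`w (y - mn²) < 1`); and `x = 0` forces `(x,y) ∈ {T, -T}`. [cite: SilvermanAEC2009, VII.§2] -/
theorem val_y_lt_one_or (he : y ^ 2 + (n - m) * x * y - m * n ^ 2 * y = x ^ 3 - m * n * x ^ 2)
    (hx : w x < 1) : w y < 1 ∨ w (y - m * n ^ 2) < 1 := by
  have hy : w y ≤ 1 := val_y_le_one w hm hn he hx.le
  -- `y (y - mn²) = x² (x - mn) - (n - m) x y` has valuation `< 1`
  have h1 : y * (y - m * n ^ 2) = x * (x * (x - m * n) - (n - m) * y) := by linear_combination he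
  have hsmall : w (y * (y - m * n ^ 2)) < 1 := by
    rw [h1, map_mul]
    refine mul_lt_one_of_lt_of_le hx ((Valuation.map_sub w _ _).trans (max_le ?_ ?_))
    · rw [map_mul]
      exact mul_le_one' hx.le ((Valuation.map_sub w _ _).trans (max_le hx.le
        (by rw [map_mul, hm, hn, one_mul])))
    · rw [map_mul]; exact mul_le_one' (val_n_sub_m_le w hm hn) hy
  by_contra hno
  push Not at hno
  obtain ⟨h2, h3⟩ := hno
  have h2' : w y = 1 := le_antisymm hy h2
  have h3' : 1 ≤ w (y - m * n ^ 2) := h3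
  rw [map_mul, h2', one_mul] at hsmall
  exact absurd (h3'.trans_lt hsmall) (lt_irrefl 1)

/-- **Main lemma: `w (f_T(P))` is a fifth power for every affine `P ≠ T` on `E_{m,n}`** when `m, n`
are `w`-units: there is `z ≠ 0` in `L` with `w (x y - n x² + n² y) = w(z)⁵`.
[cite: SilvermanAEC2009, Exercise 10.1(c) and Thm. X.1.1(c) (proof)]
[cite: Fisher2001FiveSevenDescent, §2] -/
theorem exists_val_kummerFn_eq_pow
    (he : y ^ 2 + (n - m) * x * y - m * n ^ 2 * y = x ^ 3 - m * n * x ^ 2) (hT : ¬ (x = 0 ∧ y = 0)) :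
    ∃ z : L, z ≠ 0 ∧ w (x * y - n * x ^ 2 + n ^ 2 * y) = w z ^ 5 := by
  rcases lt_trichotomy (w x) 1 with hx | hx | hx
  · rcases val_y_lt_one_or w hm hn he hx with hy | hy
    · -- reduces to `T`: `x ≠ 0` (else `y = 0` too) and `w f_T = w x ^ 5`
      have hx0 : x ≠ 0 := by
        intro h0
        apply hT
        refine ⟨h0, ?_⟩
        have h1 : y * (y - m * n ^ 2) = 0 := by
          have := eqn_factored he
          rw [h0] at this
          linear_combination this
        rcases mul_eq_zero.mp h1 with h | h
        · exact h
        · exfalso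
          -- `y = mn²` is a unit, contradicting `w y < 1`
          have hy1 : w y = 1 := by rw [sub_eq_zero.mp h]; exact val_mn2 w hm hn
          rw [hy1] at hy
          exact lt_irrefl 1 hy
      exact ⟨x, hx0, val_kummerFn_of_lt_one_of_lt_one w hm hn he hx hy⟩
    · exact ⟨1, one_ne_zero, by
        rw [map_one, one_pow]; exact val_kummerFn_of_lt_one_of_val_sub_lt_one w hm hn hx hy⟩
  · exact ⟨1, one_ne_zero, by rw [map_one, one_pow]; exact val_kummerFn_of_eq_one w hm hn he hx⟩
  · obtain ⟨hz, h⟩ := val_kummerFn_of_one_lt w hm hn he hx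
    exact ⟨y / x, hz, h⟩

/-- **`f_T` does not vanish off `T`** (its valuation is `w(z)⁵ ≠ 0`). [cite: SilvermanAEC2009, Exercise 10.1(c)] -/
theorem kummerFn_ne_zero_of_ne
    (he : y ^ 2 + (n - m) * x * y - m * n ^ 2 * y = x ^ 3 - m * n * x ^ 2) (hT : ¬ (x = 0 ∧ y = 0)) :
    x * y - n * x ^ 2 + n ^ 2 * y ≠ 0 := by
  obtain ⟨z, hz0, hz⟩ := exists_val_kummerFn_eq_pow w hm hn he hT
  intro h0
  rw [h0, map_zero] at hz
  exact pow_ne_zero 5 ((map_ne_zero w).mpr hz0) hz.symm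

end Units

end KubertTateKummer

end Literature.NumberTheory.EllipticCurves
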